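import Mathlib
import Summits.ResolutionOfSingularities.ResolutionOfSingularities.Theorems.WeightedInvariantLocalWeightedDropWildMonicKangarooBoundCases
import Summits.ResolutionOfSingularities.ResolutionOfSingularities.Theorems.WeightedInvariantLocalWeightedDropWildPurePowerFlagDefs

/-!
# `WeightedInvariant.LocalWeightedDrop`, line `hasse-ridge-face-selection`, S3ρ sub-stub S3ρD₂ / S3ρ flag line (Uk-ρD3 `DropAxisKangaroo`):
# the KANGAROO BOUND along a GENERAL PLANE SHEAR `y ↦ y + φ(x)`, `ord φ = n` (stub-1's `PurePowerFlag.shift φ`)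

Crux item stmt-ResolutionOfSingularities-8899 `LocalWeightedDrop` (route `ResolutionOfSingularities/WeightedInvariant`), engine of the
door `HypersurfaceCentreConstruction` stmt-ResolutionOfSingularities-19897.  [OURS · L1 W4.3, chain w43, seat res-type-056: ROADMAP item (C8)
D-d KANGAROO → res-type-083's target `DropAxisKangaroo` (plan-1 DEALS gen 9 #12, Uk-ρD3).  MODEL: S. Perlega, arXiv:2011.14443, Ch. 6 §2.1
Prop. 6.2.3 [cite: Perlega2020, Prop. 6.2.3; Ch. 7 Lemma 7.4.4 (d_only_depends_on_strict_type) «`d_𝓕` depends only on `n` and `t`»] and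
H. Hauser, S. Perlega, Publ. RIMS 60 (2024) Lemma 2 p. 789 («`y₁ = y + t xⁿ + h₁(x)`, `ord h₁ > n` … `F = in_ω(F)(x, y₁ − t xⁿ) + K`»), whose
series-level weight line is res-lit-5's `coeff_subst_triangular_of_weight_le` (p497145) FOR A GENERAL `φ` with `ord φ ≥ n`, `[xⁿ]φ = c`.
Nothing here is a statement of H. Hironaka's manuscript [claim: Hironaka2017, status: under-review]; OUR lemmas.]

WHY.  The flag family of res-L1-w43-stub-3 / res-type-083 (`…WildMonicFlagTripleDefs`) presents a tangent flag by a general shear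
`h ∈ k⟦x⟧`, `ord h = n` (`flagTuple d A g h = shift d (A ∘ PurePowerFlag.shift h) g`), not by the monomial twist `y ↦ y − t xⁿ` of
`…WildMonicKangaroo{Defs,Flat,BoundCases,Bound}`.  On the weight line of the weight `(1, n)` only the leading term `c xⁿ` of `φ` matters, so
every twist fact holds verbatim for `PurePowerFlag.shift φ` (letters `x = 0`, `y = 1`, `w 0 = 1`, `w 1 = n ≥ 1`, `∀ m < n, [x^m]φ = 0`,
`c = [xⁿ]φ`), with the Taylor shift `P(Y + c)`:
* `coeff_subst_pshift_of_weight_le`, `weightedOrder_subst_pshift`, `subst_pshift_ne_zero`, `flatPoly_inW_subst_pshift`;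
* `slotWOrd_pshift`, `wMin_pshift`, `yOrd_inW_pshift_eq`, and — for `c ≠ 0` — Perlega's (∗) `mul_yOrd_inW_pshift_le_dInit` and
  `dStar_pshift_le_dInit` (`d₁ ≤ d`).
The case analysis and the main bound for `B = A ∘ PurePowerFlag.shift φ` are in the siblings `…KangarooShearCases` / `…KangarooShearBound`.
AI-written; gate-accepted means sorry-free with standard axioms, not refereed.
-/

set_option linter.dupNamespace false -- mandated namespace of this single-conjunct summit

noncomputable section

namespace Summit.ResolutionOfSingularities.ResolutionOfSingularities.Theorems

namespace WildMonic

open MvPowerSeries MonicDescent Polynomial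

variable {k : Type} [Field k]

section Shear

variable {w : Fin 2 → ℕ} {n : ℕ} (hw0 : w 0 = 1) (hw1 : w 1 = n) (hn : 1 ≤ n)
  {φ : PowerSeries k} {c : k} (hφ : ∀ m, m < n → PowerSeries.coeff m φ = 0) (hc : PowerSeries.coeff n φ = c)

/-- `0 ≠ 1` in `Fin 2`. -/
theorem fin2_zero_ne_one : (0 : Fin 2) ≠ 1 := by decide

include hn hφ hc in
/-- THE SHEAR BELOW AND ON THE WEIGHT LINE (res-lit-5's `coeff_subst_triangular_of_weight_le`, letters `0, 1`): if every monomial of `F` has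
weight `≥ W`, then `F(x, y + φ(x))` has no monomial of weight `< W` and carries `P(Y + c)` on the weight line `W`, `P` the flattening of `F`. -/
theorem coeff_subst_pshift_of_weight_le (F : MvPowerSeries (Fin 2) k) {W : ℕ}
    (hW : ∀ e : Fin 2 →₀ ℕ, coeff e F ≠ 0 → W ≤ e 0 + n * e 1) (e : Fin 2 →₀ ℕ) (he : e 0 + n * e 1 ≤ W) :
    coeff e (subst (PurePowerFlag.shift φ) F) = if e 0 + n * e 1 = W then (taylor c (flatPoly 0 1 n W F)).coeff (e 1) else 0 :=
  Literature.AlgebraicGeometry.Resolution.HauserPerlega2024.coeff_subst_triangular_of_weight_le (0 : Fin 2) 1 fin2_zero_ne_one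
    (fun l => by fin_cases l <;> simp) hn hφ hc F hW e he

include hw0 hw1 hn hφ hc in
/-- THE SHEAR KEEPS THE WEIGHTED ORDER. -/
theorem weightedOrder_subst_pshift {F : MvPowerSeries (Fin 2) k} (hF : F ≠ 0) :
    (subst (PurePowerFlag.shift φ) F).weightedOrder w = F.weightedOrder w := by
  have hxy : (0 : Fin 2) ≠ 1 := fin2_zero_ne_one
  have hfin : F.weightedOrder w ≠ ⊤ := (weightedOrder_eq_top_iff w).not.mpr hF
  set W := (F.weightedOrder w).toNat with hWdef
  have hWeq : F.weightedOrder w = W := (ENat.coe_toNat hfin).symm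
  have hw : ∀ e : Fin 2 →₀ ℕ, coeff e F ≠ 0 → W ≤ e 0 + n * e 1 := fun e he => by
    have h := weightedOrder_le w he
    rw [hWeq, weight_eq hxy hw0 hw1, Nat.cast_le] at h
    exact h
  rw [hWeq]
  apply le_antisymm
  · have hhom : IsWeightedHomogeneous w (inW w F) W := isWeightedHomogeneous_inW w F
    have hP0 : flatPoly 0 1 n W F ≠ 0 := by
      rw [← flatPoly_inW hxy hw0 hw1 F rfl]
      exact fun h => inW_ne_zero w hF ((flatPoly_eq_zero_iff hxy hw0 hw1 hn hhom).mp h)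
    have hT0 : taylor c (flatPoly 0 1 n W F) ≠ 0 := fun h => hP0 ((taylor_eq_zero _ _).mp h)
    obtain ⟨j, hj⟩ : ∃ j, (taylor c (flatPoly 0 1 n W F)).coeff j ≠ 0 := ⟨_, coeff_natTrailingDegree_ne_zero.mpr hT0⟩
    have hjle : n * j ≤ W := by
      have h1 : j ≤ (taylor c (flatPoly 0 1 n W F)).natDegree := le_natDegree_of_ne_zero hj
      rw [natDegree_taylor] at h1
      exact (le_div_iff_mul_le' hn).mp (h1.trans (natDegree_flatPoly_le 0 1 n W F))
    set e : Fin 2 →₀ ℕ := Finsupp.single 0 (W - n * j) + Finsupp.single 1 j with hedef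
    have he : e 0 + n * e 1 = W := by rw [hedef, single_add_single_apply_x hxy, single_add_single_apply_y hxy]; omega
    have hcoeff : coeff e (subst (PurePowerFlag.shift φ) F) ≠ 0 := by
      rw [coeff_subst_pshift_of_weight_le hn hφ hc F hw e he.le, if_pos he, hedef, single_add_single_apply_y hxy]
      exact hj
    have h := weightedOrder_le w hcoeff
    rw [weight_eq hxy hw0 hw1, he] at h
    exact h
  · refine nat_le_weightedOrder w fun e hew => ?_
    rw [weight_eq hxy hw0 hw1] at hew
    rw [coeff_subst_pshift_of_weight_le hn hφ hc F hw e hew.le, if_neg (Nat.ne_of_lt hew)]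

include hw0 hw1 hn hφ hc in
/-- A non-zero series stays non-zero under the shear. -/
theorem subst_pshift_ne_zero {F : MvPowerSeries (Fin 2) k} (hF : F ≠ 0) : subst (PurePowerFlag.shift φ) F ≠ 0 := by
  intro h
  have h1 := weightedOrder_subst_pshift hw0 hw1 hn hφ hc hF
  rw [h, weightedOrder_zero] at h1
  exact hF ((weightedOrder_eq_top_iff w).mp h1.symm)

include hw0 hw1 hn hφ hc in
/-- THE INITIAL FORM OF THE SHEARED SERIES FLATTENS TO `P(Y + c)` (`W = ord_w F`): only the leading term `c xⁿ` of `φ` is seen on the weight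
line (Perlega Lemma 7.4.4: «`d_𝓕` depends only on the strict type `(n, t)`»). -/
theorem flatPoly_inW_subst_pshift {F : MvPowerSeries (Fin 2) k} (hF : F ≠ 0) {W : ℕ} (hW : (F.weightedOrder w).toNat = W) :
    flatPoly 0 1 n W (inW w (subst (PurePowerFlag.shift φ) F)) = taylor c (flatPoly 0 1 n W (inW w F)) := by
  have hxy : (0 : Fin 2) ≠ 1 := fin2_zero_ne_one
  have hfin : F.weightedOrder w ≠ ⊤ := (weightedOrder_eq_top_iff w).not.mpr hF
  have hWeq : F.weightedOrder w = W := by rw [← hW]; exact (ENat.coe_toNat hfin).symm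
  have hW' : ((subst (PurePowerFlag.shift φ) F).weightedOrder w).toNat = W := by
    rw [weightedOrder_subst_pshift hw0 hw1 hn hφ hc hF, hW]
  have hw : ∀ e : Fin 2 →₀ ℕ, coeff e F ≠ 0 → W ≤ e 0 + n * e 1 := fun e he => by
    have h := weightedOrder_le w he
    rw [hWeq, weight_eq hxy hw0 hw1, Nat.cast_le] at h
    exact h
  rw [flatPoly_inW hxy hw0 hw1 _ hW', flatPoly_inW hxy hw0 hw1 _ hW]
  ext j
  rw [coeff_flatPoly]
  by_cases hj : j ≤ W / n
  · have hjn := (le_div_iff_mul_le' hn).mp hj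
    rw [if_pos hj, coeff_subst_pshift_of_weight_le hn hφ hc F hw _
        (by rw [single_add_single_apply_x hxy, single_add_single_apply_y hxy]; omega),
      if_pos (by rw [single_add_single_apply_x hxy, single_add_single_apply_y hxy]; omega), single_add_single_apply_y hxy]
  · rw [if_neg hj]
    symm
    apply coeff_eq_zero_of_natDegree_lt
    rw [natDegree_taylor]
    exact lt_of_le_of_lt (natDegree_flatPoly_le 0 1 n W F) (not_le.mp hj)

variable {d : ℕ} (A : Fin d → MvPowerSeries (Fin 2) k)

include hw0 hw1 hn hφ hc in
/-- The shear keeps every scaled slot order. -/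
theorem slotWOrd_pshift (j : Fin d) : slotWOrd w (fun j => subst (PurePowerFlag.shift φ) (A j)) j = slotWOrd w A j := by
  unfold slotWOrd
  by_cases hA : A j = 0
  · simp only [hA]
    rw [← substAlgHom_apply (PurePowerFlag.hasSubst_shift' φ ?_), map_zero]
    by_cases hn0 : n = 0
    · omega
    · have h := hφ 0 (Nat.pos_of_ne_zero hn0)
      rwa [PowerSeries.coeff_zero_eq_constantCoeff] at h
  · simp only
    rw [weightedOrder_subst_pshift hw0 hw1 hn hφ hc hA]

include hw0 hw1 hn hφ hc in
/-- The shear keeps `m`. -/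
theorem wMin_pshift : wMin w (fun j => subst (PurePowerFlag.shift φ) (A j)) = wMin w A := by
  unfold wMin; exact iInf_congr fun j => slotWOrd_pshift hw0 hw1 hn hφ hc A j

include hw0 hw1 hn hφ hc in
/-- `ord_{(y)} in_w(B_j) = tdeg P_j(Y + c)` for `B = A ∘ shift φ`, `A_j ≠ 0`, `P_j` the flattening of `in_w(A_j)`. -/
theorem yOrd_inW_pshift_eq {j : Fin d} (hAj : A j ≠ 0) {W : ℕ} (hW : ((A j).weightedOrder w).toNat = W) :
    (inW w (subst (PurePowerFlag.shift φ) (A j))).weightedOrder (Pi.single 1 1) =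
      ((taylor c (flatPoly 0 1 n W (inW w (A j)))).natTrailingDegree : ℕ) := by
  have hxy : (0 : Fin 2) ≠ 1 := fin2_zero_ne_one
  have hB0 : subst (PurePowerFlag.shift φ) (A j) ≠ 0 := subst_pshift_ne_zero hw0 hw1 hn hφ hc hAj
  have hWB : ((subst (PurePowerFlag.shift φ) (A j)).weightedOrder w).toNat = W := by
    rw [weightedOrder_subst_pshift hw0 hw1 hn hφ hc hAj, hW]
  have hhomB : IsWeightedHomogeneous w (inW w (subst (PurePowerFlag.shift φ) (A j))) W := by
    rw [← hWB]; exact isWeightedHomogeneous_inW w _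
  rw [weightedOrder_single_eq_natTrailingDegree hxy hw0 hw1 hn hhomB (inW_ne_zero w hB0),
    flatPoly_inW_subst_pshift hw0 hw1 hn hφ hc hAj hW]

include hw0 hw1 hn hφ hc in
/-- (∗) ON THE SUBORDINATE SIDE, GENERAL SHEAR (`c ≠ 0`): for a slot `j` attaining `m < ⊤`, `s_j · ord_{(y)} in_w(B_j) ≤ dInit w (newtonSet A)`. -/
theorem mul_yOrd_inW_pshift_le_dInit (hc0 : c ≠ 0) {m : ℕ} (hm : wMin w A = m) {j : Fin d} (hj : slotWOrd w A j = wMin w A) :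
    (slotWeight d j : ℕ∞) * (inW w (subst (PurePowerFlag.shift φ) (A j))).weightedOrder (Pi.single 1 1) ≤ (dInit w (newtonSet A) : ℕ) := by
  have hxy : (0 : Fin 2) ≠ 1 := fin2_zero_ne_one
  have hm' : wMin w A ≠ ⊤ := by rw [hm]; exact ENat.coe_ne_top m
  obtain ⟨hAj, W, hWj, -⟩ := exists_weightedOrder_eq_of_attains w A hj hm'
  have hW : ((A j).weightedOrder w).toNat = W := by rw [hWj, ENat.toNat_coe]
  have hhom : IsWeightedHomogeneous w (inW w (A j)) W := by rw [← hW]; exact isWeightedHomogeneous_inW w (A j)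
  have hP0 : flatPoly 0 1 n W (inW w (A j)) ≠ 0 :=
    fun h => inW_ne_zero w hAj ((flatPoly_eq_zero_iff hxy hw0 hw1 hn hhom).mp h)
  rw [yOrd_inW_pshift_eq hw0 hw1 hn hφ hc A hAj hW, ← Nat.cast_mul, Nat.cast_le]
  refine le_trans ?_ (mul_spread_le_dInit hxy hw0 hw1 hn A hm hj hW)
  apply Nat.mul_le_mul_left
  have h := natTrailingDegree_taylor_add_le hc0 hP0
  omega

include hw0 hw1 hn hφ hc in
/-- PERLEGA'S `d₁ ≤ d` ALONG A GENERAL SHEAR: `dStar 1 w (A ∘ shift φ) ≤ dInit w (newtonSet A)` (`c ≠ 0`). -/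
theorem dStar_pshift_le_dInit (hc0 : c ≠ 0) {m : ℕ} (hm : wMin w A = m) :
    dStar 1 w (fun j => subst (PurePowerFlag.shift φ) (A j)) ≤ (dInit w (newtonSet A) : ℕ) := by
  have hm' : wMin w A ≠ ⊤ := by rw [hm]; exact ENat.coe_ne_top m
  obtain ⟨j, hj⟩ := exists_slotWOrd_eq_wMin w A (pos_of_wMin_ne_top w A hm')
  have hjB : slotWOrd w (fun j => subst (PurePowerFlag.shift φ) (A j)) j = wMin w (fun j => subst (PurePowerFlag.shift φ) (A j)) := by
    rw [slotWOrd_pshift hw0 hw1 hn hφ hc A j, wMin_pshift hw0 hw1 hn hφ hc A, hj]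
  exact (dStar_le 1 w _ hjB).trans (mul_yOrd_inW_pshift_le_dInit hw0 hw1 hn hφ hc A hc0 hm hj)

end Shear

end WildMonic

end Summit.ResolutionOfSingularities.ResolutionOfSingularities.Theorems

end
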